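import Summits.Ventures.CertifiedArithmetic.LowPrec.SRDyadicGridFormats
import Summits.Ventures.CertifiedArithmetic.LowPrec.SRInnerProductLimitedBits
import HarnessLib

/-!
# The product law: rounding an exact product needs `max(m+1, bias+m−1)` random bits, every format

HONEST FRAMING: certified error envelopes and provably optimal rounding/accumulation schemes for
low-precision formats under stated cost models; every table by two implementations; no hardware or
vendor claims.

File LXXXI of the SR slice.  LXXIX/LXXX bound the random-bit budget of a TWO-stage inner product
`p̂ₖ = SR(xₖyₖ)`, `ŝ ← SR(ŝ + p̂ₖ)` by the product table and the pair table; the pair table is the tree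
budget `emaxCode − 1` (sharp), but for the product table the grid bound `emaxCode − 1 + j` is far from
sharp: the HOME certificate `certs/sr/gen15/budgets` found, by exhaustive enumeration on eight formats,
the law `PROD = min(emaxCode − 1 + j, max(m + 1, j))`, `j = bias + m − 1`.  Here the upper bound
`max(m + 1, j)` is PROVED for every minifloat format — structurally, from the binade of the product —
and the two-stage inner product of format vectors is shown exact in law with the TREE budget whenever
`max(m+1, j) ≤ emaxCode − 1` (all OCP / IEEE formats): E4M3 `14`, E5M2 `29`, binary16 `29`, bfloat16 and
binary32 `253` bits, against `23 / 45 / 53 / 386 / 402` one-stage (LXXX).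

* `MiniFloat.exists_sig_exp` — every datum has magnitude `M · 2^e · quantum` with `M < 2^(m+1)`;
* `Format.rdGrid_cast` / `Format.ruGrid_cast` — `rdGrid r = ⌊r/2^s⌋2^s`, `ruGrid r = ⌈r/2^s⌉2^s` as
  rationals (`s = shift ⌊r⌋`), `Format.two_pow_shift_le` — `2^(m+s) ≤ r` when `s ≥ 1` (the binade);
* `MiniFloat.probUp_valueSet_trichotomy` — for `|c| ≤ maxRat` the exact up-probability over `valueSet φ`
  is `0`, `r/2^s − ⌊r/2^s⌋` or `⌈r/2^s⌉ − r/2^s` (`r = |c|/quantum`), both signs at once;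
* `abs_clamp_valueSet_le` — the clamped value is always in the hull;
* **`valueSet_dyadic_pUp_mul`** — THE PRODUCT LAW (upper bound): for `a, b ∈ valueSet φ` the
  up-probability of `a · b` is a `max(m+1, j)`-bit dyadic (in range, subnormal or saturating);
* **`valueSet_ip2_exact`** — two-stage inner products of format vectors under `A`/`B`/`C` with
  `N ≥ max(emaxCode − 1, m + 1, j)` bits are the exact-SR two-stage inner product in law (every length,
  start, test function); closed forms `e4m3_ip2_exact (14)`, `e5m2_ip2_exact (29)`, `binary16_ip2_exact
  (29)`, `bfloat16_ip2_exact (253)`, `binary32_ip2_exact (253)` — **two-stage FP8 / FP16 / FP32 inner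
  products need only the tree budget**;
* sharpness of the product law by kernel on the literals (`prod_law_witnesses`: E3M2 `(5/16)² = 25/256`
  has order `4 = j > m+1`; E2M3 `(9/8)(15/8) = 135/64` has order `4 = m+1 > j`; E4M3 `3·2⁻¹⁸` order `9`;
  E5M2 `3·2⁻³²` order `16`).
-/

namespace Literature.ComputerArithmetic.FloatingPoint

namespace Format

variable {φ : Format}

/-- `rdGrid r = ⌊r/2^s⌋ · 2^s` as rationals, `s = shift ⌊r⌋`, on `[0, maxScaled]`. -/
theorem rdGrid_cast {r : ℚ} (hr : 0 ≤ r) (hle : r ≤ φ.maxScaled) :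
    (φ.rdGrid r : ℚ) = (⌊r / (2 : ℚ) ^ φ.shift ⌊r⌋.toNat⌋ : ℚ) * 2 ^ φ.shift ⌊r⌋.toNat := by
  have hc : (0 : ℚ) < 2 ^ φ.shift ⌊r⌋.toNat := by positivity
  have h0 : 0 ≤ ⌊r / (2 : ℚ) ^ φ.shift ⌊r⌋.toNat⌋ := Int.floor_nonneg.mpr (div_nonneg hr hc.le)
  have e1 : ((⌊r / (2 : ℚ) ^ φ.shift ⌊r⌋.toNat⌋.toNat : ℕ) : ℚ)
      = (⌊r / (2 : ℚ) ^ φ.shift ⌊r⌋.toNat⌋ : ℚ) := by exact_mod_cast Int.toNat_of_nonneg h0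
  rw [rdGrid_eq_floor_mul hr hle]; push_cast; rw [e1]

/-- `ruGrid r = ⌈r/2^s⌉ · 2^s` as rationals on `[0, maxScaled]`. -/
theorem ruGrid_cast {r : ℚ} (hr : 0 ≤ r) (hle : r ≤ φ.maxScaled) :
    (φ.ruGrid r : ℚ) = (⌈r / (2 : ℚ) ^ φ.shift ⌊r⌋.toNat⌉ : ℚ) * 2 ^ φ.shift ⌊r⌋.toNat := by
  have hc : (0 : ℚ) < 2 ^ φ.shift ⌊r⌋.toNat := by positivity
  have h0 : 0 ≤ ⌈r / (2 : ℚ) ^ φ.shift ⌊r⌋.toNat⌉ := Int.ceil_nonneg (div_nonneg hr hc.le)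
  have e2 : ((⌈r / (2 : ℚ) ^ φ.shift ⌊r⌋.toNat⌉.toNat : ℕ) : ℚ)
      = (⌈r / (2 : ℚ) ^ φ.shift ⌊r⌋.toNat⌉ : ℚ) := by exact_mod_cast Int.toNat_of_nonneg h0
  unfold ruGrid; rw [if_pos hle]; push_cast; rw [e2]

/-- THE BINADE: if the spacing exponent `s = shift ⌊r⌋` is positive then `2^(m+s) ≤ r`. -/
theorem two_pow_shift_le {r : ℚ} (hr : 0 ≤ r) (hs : 1 ≤ φ.shift ⌊r⌋.toNat) :
    (2 : ℚ) ^ (φ.manBits + φ.shift ⌊r⌋.toNat) ≤ r := by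
  have hn : ¬ ⌊r⌋.toNat < 2 ^ (φ.manBits + 1) := fun h => by
    have := shift_eq_zero_of_lt (φ := φ) h; omega
  have h2 : 2 ^ φ.manBits ≤ ⌊r⌋.toNat :=
    le_trans (Nat.pow_le_pow_right (by norm_num) (Nat.le_succ _)) (not_lt.mp hn)
  have h3 := pow_shift_le (φ := φ) h2
  have h4 : ((⌊r⌋.toNat : ℕ) : ℚ) ≤ r := by
    have e : ((⌊r⌋.toNat : ℕ) : ℚ) = (⌊r⌋ : ℚ) := by
      exact_mod_cast Int.toNat_of_nonneg (Int.floor_nonneg.mpr hr)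
    rw [e]; exact Int.floor_le r
  exact le_trans (by exact_mod_cast h3) h4

/-- The quantum is `2^{-j}`, `j = bias + m − 1`, whenever `bias + m ≥ 1`. -/
theorem quantum_eq_inv_two_pow (h : 1 ≤ φ.bias + φ.manBits) :
    φ.quantum = 1 / 2 ^ (φ.bias + φ.manBits - 1) := by
  have hq := φ.quantum_pos
  have h2 : (0 : ℚ) < 2 ^ (φ.bias + φ.manBits - 1) := by positivity
  have e := quantum_eq_two_pow_mul_sq h
  have e' : φ.quantum * (2 ^ (φ.bias + φ.manBits - 1) * φ.quantum - 1) = 0 := by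
    linear_combination (-1 : ℚ) * e
  rcases mul_eq_zero.mp e' with h0 | h0
  · exact absurd h0 hq.ne'
  · field_simp; linarith

end Format

namespace MiniFloat

open Format

variable {φ : Format}

/-- Every datum has magnitude `M · 2^e` quanta with an `(m+1)`-bit significand `M < 2^(m+1)`. -/
theorem exists_sig_exp (x : MiniFloat φ) :
    ∃ M e : ℕ, M < 2 ^ (φ.manBits + 1) ∧ (x.scaledMag : ℚ) = M * 2 ^ e := by
  unfold scaledMag Format.scaled
  by_cases h : x.expCode = 0
  · refine ⟨x.man, 0, lt_of_lt_of_le x.man_lt (Nat.pow_le_pow_right (by norm_num) (by omega)), ?_⟩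
    rw [if_pos h]; simp
  · refine ⟨2 ^ φ.manBits + x.man, x.expCode - 1, ?_, ?_⟩
    · have := x.man_lt; rw [pow_succ]; omega
    · rw [if_neg h]; push_cast; ring

/-- The clamped value over `valueSet φ` is always in the hull `[−maxRat, maxRat]`. -/
theorem abs_clamp_valueSet_le (φ : Format) (c : ℚ) :
    |Summit.Ventures.CertifiedArithmetic.LowPrec.SR.clamp (valueSet φ) c| ≤ φ.maxRat := by
  have hF := valueSet_nonempty φ
  have hmin : -φ.maxRat ≤ (valueSet φ).min' hF :=
    (abs_le.mp (by
      obtain ⟨y, hy⟩ := mem_valueSet.mp ((valueSet φ).min'_mem hF)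
      rw [← hy]; exact abs_toRat_le_maxRat y)).1
  have hmax : (valueSet φ).max' hF ≤ φ.maxRat :=
    (abs_le.mp (by
      obtain ⟨y, hy⟩ := mem_valueSet.mp ((valueSet φ).max'_mem hF)
      rw [← hy]; exact abs_toRat_le_maxRat y)).2
  unfold Summit.Ventures.CertifiedArithmetic.LowPrec.SR.clamp
  rw [dif_pos hF, abs_le]
  constructor
  · exact hmin.trans (le_max_left _ _)
  · exact max_le ((Finset.min'_le_max' _ hF).trans hmax) ((min_le_right _ _).trans hmax)

/-- **Trichotomy of the exact up-probability over a format**, both signs at once: for `|c| ≤ maxRat`,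
with `r = |c|/quantum` and `s = shift ⌊r⌋`, `probUp (valueSet φ) c` is `0` (no rounding),
`r/2^s − ⌊r/2^s⌋` (`c ≥ 0`) or `⌈r/2^s⌉ − r/2^s` (`c < 0`). -/
theorem probUp_valueSet_trichotomy (φ : Format) {c : ℚ} (hc : |c| ≤ φ.maxRat) :
    ConnollyHighamMary2021.probUp (valueSet φ) c = 0 ∨
    ConnollyHighamMary2021.probUp (valueSet φ) c
      = |c| / φ.quantum / 2 ^ φ.shift ⌊|c| / φ.quantum⌋.toNat
        - ⌊|c| / φ.quantum / 2 ^ φ.shift ⌊|c| / φ.quantum⌋.toNat⌋ ∨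
    ConnollyHighamMary2021.probUp (valueSet φ) c
      = ⌈|c| / φ.quantum / 2 ^ φ.shift ⌊|c| / φ.quantum⌋.toNat⌉
        - |c| / φ.quantum / 2 ^ φ.shift ⌊|c| / φ.quantum⌋.toNat := by
  have hq := φ.quantum_pos
  set r := |c| / φ.quantum with hr_def
  set s := φ.shift ⌊r⌋.toNat with hs_def
  have hr : 0 ≤ r := div_nonneg (abs_nonneg c) hq.le
  have hle : r ≤ φ.maxScaled := by rw [hr_def, div_le_iff₀ hq]; exact hc.trans (le_of_eq rfl)
  have h2s : (0 : ℚ) < 2 ^ s := by positivity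
  have hD := chm_roundDown_eq hc
  have hU := chm_roundUp_eq hc
  rw [toRat_roundDown] at hD; rw [toRat_roundUp] at hU
  have h1 := Int.floor_le_ceil (r / (2 : ℚ) ^ s)
  have h2 := Int.ceil_le_floor_add_one (r / (2 : ℚ) ^ s)
  unfold ConnollyHighamMary2021.probUp
  rw [hD, hU]
  by_cases hneg : c < 0
  · rw [if_pos hneg, if_pos hneg, ← hr_def, rdGrid_cast hr hle, ruGrid_cast hr hle, ← hs_def]
    have hcr : c = -(r * φ.quantum) := by
      rw [hr_def, div_mul_cancel₀ _ hq.ne', abs_of_neg hneg, neg_neg]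
    rcases eq_or_lt_of_le h1 with he | hlt
    · left; rw [he]; simp
    · right; right
      have hce : (⌈r / (2 : ℚ) ^ s⌉ : ℚ) = ⌊r / (2 : ℚ) ^ s⌋ + 1 := by
        have : ⌈r / (2 : ℚ) ^ s⌉ = ⌊r / (2 : ℚ) ^ s⌋ + 1 := le_antisymm h2 (by omega)
        rw [this]; push_cast; ring
      rw [hcr, hce, div_eq_iff (by nlinarith [hq, h2s])]
      field_simp
      ring
  · rw [if_neg hneg, if_neg hneg, ← hr_def, rdGrid_cast hr hle, ruGrid_cast hr hle, ← hs_def]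
    have hcr : c = r * φ.quantum := by
      rw [hr_def, div_mul_cancel₀ _ hq.ne', abs_of_nonneg (not_lt.mp hneg)]
    rcases eq_or_lt_of_le h1 with he | hlt
    · left; rw [he]; simp
    · right; left
      have hce : (⌈r / (2 : ℚ) ^ s⌉ : ℚ) = ⌊r / (2 : ℚ) ^ s⌋ + 1 := by
        have : ⌈r / (2 : ℚ) ^ s⌉ = ⌊r / (2 : ℚ) ^ s⌋ + 1 := le_antisymm h2 (by omega)
        rw [this]; push_cast; ring
      rw [hcr, hce, div_eq_iff (by nlinarith [hq, h2s])]
      field_simp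
      ring

end MiniFloat

end Literature.ComputerArithmetic.FloatingPoint

namespace Summit.Ventures.CertifiedArithmetic.LowPrec.SR.LimitedBits

open Literature.ComputerArithmetic.P3109
open Literature.ComputerArithmetic.ConnollyHighamMary2021
open Literature.ComputerArithmetic.FloatingPoint (Format MiniFloat)
open Literature.ComputerArithmetic.FloatingPoint.MiniFloat (valueSet valueSet_nonempty)
open Summit.Ventures.CertifiedArithmetic.LowPrec.SR
open Finset STree

section DyadicLemmas

variable {K : Type*} [Field K] [LinearOrder K] [IsStrictOrderedRing K]

omit [LinearOrder K] [IsStrictOrderedRing K] in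
/-- `0` is dyadic of every order. -/
theorem dyadic_zero (N : ℕ) : Dyadic N (0 : K) := ⟨0, by simp⟩

omit [LinearOrder K] [IsStrictOrderedRing K] in
/-- Dyadics are stable under subtracting an integer. -/
theorem Dyadic.sub_int {N : ℕ} {η : K} (h : Dyadic N η) (z : ℤ) : Dyadic N (η - z) := by
  obtain ⟨m, hm⟩ := h; exact ⟨m - z * 2 ^ N, by push_cast; rw [hm]; ring⟩

omit [LinearOrder K] [IsStrictOrderedRing K] in
/-- Dyadics are stable under subtraction from an integer. -/
theorem Dyadic.int_sub {N : ℕ} {η : K} (h : Dyadic N η) (z : ℤ) : Dyadic N (z - η) := by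
  obtain ⟨m, hm⟩ := h; exact ⟨z * 2 ^ N - m, by push_cast; rw [hm]; ring⟩

end DyadicLemmas

/-! ### The product law -/

/-- Core arithmetic: `M · 2^e / 2^j / 2^s` is an `N`-bit dyadic as soon as `j + s ≤ N + e`. -/
theorem dyadic_sig_div {M e j s N : ℕ} (h : j + s ≤ N + e) :
    Dyadic N ((M : ℚ) * 2 ^ e / 2 ^ j / 2 ^ s) := by
  refine ⟨(M : ℤ) * 2 ^ (N + e - (j + s)), ?_⟩
  have hd : N + e - (j + s) + (j + s) = e + N := by omega
  push_cast
  rw [div_div, ← pow_add, div_mul_eq_mul_div, eq_div_iff (by positivity)]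
  calc (M : ℚ) * 2 ^ (N + e - (j + s)) * 2 ^ (j + s)
      = M * 2 ^ (N + e - (j + s) + (j + s)) := by rw [pow_add]; ring
    _ = M * 2 ^ (e + N) := by rw [hd]
    _ = M * 2 ^ e * 2 ^ N := by rw [pow_add]; ring

/-- **THE PRODUCT LAW (every format).** For `a, b ∈ valueSet φ` (`bias + m ≥ 1`, `j = bias + m − 1`),
the exact-SR up-probability of the product `a · b` — normal, subnormal or saturating — is a
`max(m + 1, j)`-bit dyadic: the product of two `(m+1)`-bit significands leaves at most `m + 1` bits
below the rounding position of its binade, and below the normal range at most `j`. -/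
theorem valueSet_dyadic_pUp_mul (φ : Format) (h1 : 1 ≤ φ.bias + φ.manBits) {a b : ℚ}
    (ha : a ∈ valueSet φ) (hb : b ∈ valueSet φ) :
    Dyadic (max (φ.manBits + 1) (φ.bias + φ.manBits - 1)) (pUp (valueSet φ) (a * b)) := by
  set N := max (φ.manBits + 1) (φ.bias + φ.manBits - 1) with hN
  set j := φ.bias + φ.manBits - 1 with hj
  have hF := valueSet_nonempty φ
  have hq := φ.quantum_pos
  have hqj : φ.quantum = 1 / 2 ^ j := Format.quantum_eq_inv_two_pow h1
  show Dyadic N (probUp (valueSet φ) (clamp (valueSet φ) (a * b)))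
  rcases clamp_eq_self_or_mem hF (a * b) with hcl | hcl
  swap
  · -- saturating onto a value (or an exactly representable product): no rounding
    unfold probUp
    rw [roundDown_eq_self_of_mem hcl, roundUp_eq_self_of_mem hcl, sub_self, zero_div]
    exact dyadic_zero N
  rw [hcl]
  have hc : |a * b| ≤ φ.maxRat := by rw [← hcl]; exact MiniFloat.abs_clamp_valueSet_le φ (a * b)
  -- the significand structure of the product
  obtain ⟨x, rfl⟩ := MiniFloat.mem_valueSet.mp ha
  obtain ⟨y, rfl⟩ := MiniFloat.mem_valueSet.mp hb
  obtain ⟨Ma, α, hMa, hxa⟩ := MiniFloat.exists_sig_exp x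
  obtain ⟨Mb, β, hMb, hyb⟩ := MiniFloat.exists_sig_exp y
  have hr : |x.toRat * y.toRat| / φ.quantum = ((Ma * Mb : ℕ) : ℚ) * 2 ^ (α + β) / 2 ^ j := by
    rw [abs_mul, MiniFloat.abs_toRat, MiniFloat.abs_toRat, hxa, hyb, hqj]; push_cast
    field_simp; ring
  set r := |x.toRat * y.toRat| / φ.quantum with hr_def
  set s := φ.shift ⌊r⌋.toNat with hs_def
  have hr0 : 0 ≤ r := div_nonneg (abs_nonneg _) hq.le
  -- the exponent inequality `j + s ≤ N + (α + β)` from the binade of the product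
  have hexp : j + s ≤ N + (α + β) := by
    by_cases hs0 : s = 0
    · rw [hs0]; omega
    · have h2 := Format.two_pow_shift_le (φ := φ) hr0 (by omega)
      rw [← hs_def, hr] at h2
      have hlt : ((Ma * Mb : ℕ) : ℚ) * 2 ^ (α + β) / 2 ^ j
          < 2 ^ (φ.manBits + 1) * 2 ^ (φ.manBits + 1) * 2 ^ (α + β) / 2 ^ j := by
        apply div_lt_div_of_pos_right _ (by positivity)
        apply mul_lt_mul_of_pos_right _ (by positivity)
        have hM : ((Ma * Mb : ℕ) : ℚ) < 2 ^ (φ.manBits + 1) * 2 ^ (φ.manBits + 1) := by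
          have : Ma * Mb < 2 ^ (φ.manBits + 1) * 2 ^ (φ.manBits + 1) :=
            mul_lt_mul'' hMa hMb (Nat.zero_le _) (Nat.zero_le _)
          exact_mod_cast this
        exact hM
      have h3 := lt_of_le_of_lt h2 hlt
      rw [lt_div_iff₀ (by positivity), ← pow_add, ← pow_add, ← pow_add] at h3
      have h4 := (pow_lt_pow_iff_right₀ (by norm_num : (1 : ℚ) < 2)).mp h3
      omega
  have hcore : Dyadic N (r / 2 ^ s) := by rw [hr]; exact dyadic_sig_div hexp
  rcases MiniFloat.probUp_valueSet_trichotomy φ hc with h0 | hpos | hneg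
  · rw [h0]; exact dyadic_zero N
  · rw [hpos]; exact hcore.sub_int _
  · rw [hneg]; exact hcore.int_sub _

/-! ### Two-stage inner products, every format -/

/-- **Two-stage inner products, every format.** `p̂ₖ = SR_N(xₖyₖ)`, `ŝ ← SR_N(ŝ + p̂ₖ)` for format
vectors under `A`, `B`, `C` with `N ≥ max(emaxCode − 1, m + 1, bias + m − 1)` random bits is the
exact-SR two-stage inner product in law (every length, every format start, every test function). -/
theorem valueSet_ip2_exact (φ : Format) (h1 : 1 ≤ φ.bias + φ.manBits) {N : ℕ}
    (hN : max (φ.emaxCode - 1) (max (φ.manBits + 1) (φ.bias + φ.manBits - 1)) ≤ N) {x y : ℕ → ℚ}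
    (hx : ∀ k, x k ∈ valueSet φ) (hy : ∀ k, y k ∈ valueSet φ) {s : ℚ} (hs : s ∈ valueSet φ)
    (n : ℕ) (f : ℚ → ℚ) :
    ipExpQ (valueSet φ) (probAwayA N) (fun k => x k * y k) n f s
        = ipExp (valueSet φ) (fun k => x k * y k) n f s ∧
    ipExpQ (valueSet φ) (probAwayB N) (fun k => x k * y k) n f s
        = ipExp (valueSet φ) (fun k => x k * y k) n f s ∧
    ipExpQ (valueSet φ) (probAwayC N) (fun k => x k * y k) n f s
        = ipExp (valueSet φ) (fun k => x k * y k) n f s := by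
  have hF := valueSet_nonempty φ
  have hP : ∀ k, Dyadic N (pUp (valueSet φ) (x k * y k)) := fun k =>
    dyadic_mono ((le_max_right _ _).trans hN) (valueSet_dyadic_pUp_mul φ h1 (hx k) (hy k))
  have hS : ∀ a ∈ valueSet φ, ∀ b ∈ valueSet φ, Dyadic N (pUp (valueSet φ) (a + b)) :=
    fun a ha b hb => dyadic_mono ((le_max_left _ _).trans hN)
      (valueSet_dyadic_pUp φ (((valueSet_gridFormat φ).1 a ha).add ((valueSet_gridFormat φ).1 b hb)))
  obtain ⟨hA, hB, hC⟩ := probAwayABC_of_dyadic_le (K := ℚ) (le_refl N)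
  exact ⟨ipExpQ_eq_ipExp_of_tables hF hA hP hS hs n f, ipExpQ_eq_ipExp_of_tables hF hB hP hS hs n f,
    ipExpQ_eq_ipExp_of_tables hF hC hP hS hs n f⟩

/-- **E4M3 two-stage inner products: fourteen bits** (the tree budget; one-stage needs `23`). -/
theorem e4m3_ip2_exact {N : ℕ} (hN : 14 ≤ N) {x y : ℕ → ℚ} (hx : ∀ k, x k ∈ valueSet Format.E4M3)
    (hy : ∀ k, y k ∈ valueSet Format.E4M3) {s : ℚ} (hs : s ∈ valueSet Format.E4M3) (n : ℕ)
    (f : ℚ → ℚ) :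
    ipExpQ (valueSet Format.E4M3) (probAwayA N) (fun k => x k * y k) n f s
        = ipExp (valueSet Format.E4M3) (fun k => x k * y k) n f s ∧
    ipExpQ (valueSet Format.E4M3) (probAwayB N) (fun k => x k * y k) n f s
        = ipExp (valueSet Format.E4M3) (fun k => x k * y k) n f s ∧
    ipExpQ (valueSet Format.E4M3) (probAwayC N) (fun k => x k * y k) n f s
        = ipExp (valueSet Format.E4M3) (fun k => x k * y k) n f s :=
  valueSet_ip2_exact _ (by decide) (le_trans (by decide) hN)
    hx hy hs n f

/-- **E5M2 two-stage inner products: twenty-nine bits** (one-stage needs `45`). -/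
theorem e5m2_ip2_exact {N : ℕ} (hN : 29 ≤ N) {x y : ℕ → ℚ} (hx : ∀ k, x k ∈ valueSet Format.E5M2)
    (hy : ∀ k, y k ∈ valueSet Format.E5M2) {s : ℚ} (hs : s ∈ valueSet Format.E5M2) (n : ℕ)
    (f : ℚ → ℚ) :
    ipExpQ (valueSet Format.E5M2) (probAwayA N) (fun k => x k * y k) n f s
        = ipExp (valueSet Format.E5M2) (fun k => x k * y k) n f s ∧
    ipExpQ (valueSet Format.E5M2) (probAwayB N) (fun k => x k * y k) n f s
        = ipExp (valueSet Format.E5M2) (fun k => x k * y k) n f s ∧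
    ipExpQ (valueSet Format.E5M2) (probAwayC N) (fun k => x k * y k) n f s
        = ipExp (valueSet Format.E5M2) (fun k => x k * y k) n f s :=
  valueSet_ip2_exact _ (by decide) (le_trans (by decide) hN)
    hx hy hs n f

/-- **binary16 two-stage inner products: twenty-nine bits** (one-stage needs `53`). -/
theorem binary16_ip2_exact {N : ℕ} (hN : 29 ≤ N) {x y : ℕ → ℚ}
    (hx : ∀ k, x k ∈ valueSet Format.Binary16) (hy : ∀ k, y k ∈ valueSet Format.Binary16) {s : ℚ}
    (hs : s ∈ valueSet Format.Binary16) (n : ℕ) (f : ℚ → ℚ) :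
    ipExpQ (valueSet Format.Binary16) (probAwayA N) (fun k => x k * y k) n f s
        = ipExp (valueSet Format.Binary16) (fun k => x k * y k) n f s ∧
    ipExpQ (valueSet Format.Binary16) (probAwayB N) (fun k => x k * y k) n f s
        = ipExp (valueSet Format.Binary16) (fun k => x k * y k) n f s ∧
    ipExpQ (valueSet Format.Binary16) (probAwayC N) (fun k => x k * y k) n f s
        = ipExp (valueSet Format.Binary16) (fun k => x k * y k) n f s :=
  valueSet_ip2_exact _ (by decide) (le_trans (by decide) hN)
    hx hy hs n f

set_option maxRecDepth 8192 in  -- the `valueSet BFloat16` membership binders unfold deeply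
/-- **bfloat16 two-stage inner products: 253 bits** (one-stage needs `386`). -/
theorem bfloat16_ip2_exact {N : ℕ} (hN : 253 ≤ N) {x y : ℕ → ℚ}
    (hx : ∀ k, x k ∈ valueSet Format.BFloat16) (hy : ∀ k, y k ∈ valueSet Format.BFloat16) {s : ℚ}
    (hs : s ∈ valueSet Format.BFloat16) (n : ℕ) (f : ℚ → ℚ) :
    ipExpQ (valueSet Format.BFloat16) (probAwayA N) (fun k => x k * y k) n f s
        = ipExp (valueSet Format.BFloat16) (fun k => x k * y k) n f s ∧
    ipExpQ (valueSet Format.BFloat16) (probAwayB N) (fun k => x k * y k) n f s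
        = ipExp (valueSet Format.BFloat16) (fun k => x k * y k) n f s ∧
    ipExpQ (valueSet Format.BFloat16) (probAwayC N) (fun k => x k * y k) n f s
        = ipExp (valueSet Format.BFloat16) (fun k => x k * y k) n f s :=
  valueSet_ip2_exact _ (by decide) (le_trans (by decide) hN)
    hx hy hs n f

set_option maxRecDepth 8192 in
/-- **binary32 two-stage inner products: 253 bits** (one-stage needs `402`). -/
theorem binary32_ip2_exact {N : ℕ} (hN : 253 ≤ N) {x y : ℕ → ℚ}
    (hx : ∀ k, x k ∈ valueSet Format.Binary32) (hy : ∀ k, y k ∈ valueSet Format.Binary32) {s : ℚ}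
    (hs : s ∈ valueSet Format.Binary32) (n : ℕ) (f : ℚ → ℚ) :
    ipExpQ (valueSet Format.Binary32) (probAwayA N) (fun k => x k * y k) n f s
        = ipExp (valueSet Format.Binary32) (fun k => x k * y k) n f s ∧
    ipExpQ (valueSet Format.Binary32) (probAwayB N) (fun k => x k * y k) n f s
        = ipExp (valueSet Format.Binary32) (fun k => x k * y k) n f s ∧
    ipExpQ (valueSet Format.Binary32) (probAwayC N) (fun k => x k * y k) n f s
        = ipExp (valueSet Format.Binary32) (fun k => x k * y k) n f s :=
  valueSet_ip2_exact _ (by decide) (le_trans (by decide) hN)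
    hx hy hs n f

/-! ### Sharpness of the product law (kernel, on the literals) -/

open FP4 Formats in
/-- The product law is attained in both regimes: E3M2 `(5/16)² = 25/256` has order `4 = j > m + 1 = 3`;
E2M3 `(9/8)(15/8) = 135/64` has order `4 = m + 1 > j = 3`; E4M3 `(2⁻⁹)(3·2⁻⁹) = 3·2⁻¹⁸` has order
`9 = j`; E5M2 `3·2⁻³²` has order `16 = j`; FP4 `(3/2)(3/2) = 9/4` has order `2 = m + 1`. -/
theorem prod_law_witnesses :
    (¬ Dyadic 3 (pUp e3m2 ((5/16 : ℚ) * (5/16))) ∧ Dyadic 4 (pUp e3m2 ((5/16 : ℚ) * (5/16)))) ∧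
    (¬ Dyadic 3 (pUp e2m3 ((9/8 : ℚ) * (15/8))) ∧ Dyadic 4 (pUp e2m3 ((9/8 : ℚ) * (15/8)))) ∧
    (¬ Dyadic 8 (pUp e4m3 ((1 / 2 ^ 9 : ℚ) * (3 / 2 ^ 9))) ∧
      Dyadic 9 (pUp e4m3 ((1 / 2 ^ 9 : ℚ) * (3 / 2 ^ 9)))) ∧
    (¬ Dyadic 15 (pUp e5m2 ((1 / 2 ^ 16 : ℚ) * (3 / 2 ^ 16))) ∧
      Dyadic 16 (pUp e5m2 ((1 / 2 ^ 16 : ℚ) * (3 / 2 ^ 16)))) ∧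
    (¬ Dyadic 1 (pUp e2m1 ((3/2 : ℚ) * (3/2))) ∧ Dyadic 2 (pUp e2m1 ((3/2 : ℚ) * (3/2)))) := by
  refine ⟨⟨by decide +kernel, by decide +kernel⟩, ⟨by decide +kernel, by decide +kernel⟩,
    ⟨by decide +kernel, by decide +kernel⟩, ⟨by decide +kernel, by decide +kernel⟩,
    ⟨by decide +kernel, by decide +kernel⟩⟩

end Summit.Ventures.CertifiedArithmetic.LowPrec.SR.LimitedBits
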